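import Summits.BirchSwinnertonDyer.BirchSwinnertonDyer.Theorems.EisensteinPrimesGoodLatticeAnacongOfCGLSProofThm221
import Summits.BirchSwinnertonDyer.BirchSwinnertonDyer.Theorems.EisensteinPrimesGoodLatticeKrizDescentTypeOfDatum
import Summits.BirchSwinnertonDyer.BirchSwinnertonDyer.Theorems.EisensteinPrimesGoodLatticeKrizTraceCondition
import Summits.BirchSwinnertonDyer.BirchSwinnertonDyer.Theorems.EisensteinPrimesGoodLatticeKrizTraceConditionAtP
import Summits.BirchSwinnertonDyer.BirchSwinnertonDyer.Theorems.EisensteinPrimesResidualPairFromRat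
import Literature.NumberTheory.EllipticCurves.KellerYin2024.AnomalousCongruenceFullDescentDatum
import Literature.NumberTheory.EllipticCurves.NoConductorOne
import HarnessLib

/-!
# [AN] — the conclusion of content stub 3a-A of crux 2 `GoodLatticeBDPValue` — at the ℚ-Teichmüller call shape, from CGLS's proof of
# Thm. 2.2.1 and Hida's Thm. I BY NAME, under EXACTLY the hypotheses of 3a-A (Good, Red, Anom, the full-descent DATUM, (hlat), K-data)
# (cell `bsd-eis`, width seat `bsd-line-x1-p1-w2` gen 26; `--supports stmt-BirchSwinnertonDyer-19032`)

WHY. The assembly `GoodLatticeAnacongOfCGLSProofThm221.anacong_of_proofThm221_of_thmI` derives [AN] from the named fact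
`CastellaGrossiLeeSkinner2022.proofThm221_congruence_of_fullEisensteinDescent` and `Hida2010MuInvariant.thmI_mu_katzLFunction_eq_zero`
GIVEN a full-Eisenstein-descent type with Kriz's conditions (1)–(5). The kernel supplies: the type with (2)–(5) from the 3a-A datum
(`GoodLatticeKrizDescentTypeOfDatum.exists_fullDescentType_of_datum`) and (1) at every good `ℓ ≠ p`
(`GoodLatticeKrizTraceCondition.kriz_one_of_hasGoodReductionAtPrime`). THIS FILE puts them together: [AN] at the call shape of the
tree's consumers of [AN] (`KatzUnitSuppliers.katzUnitAll_of_anacong`, `OfNamedFactsSix.anQ_of_thm222_OPEN`: ℚ-Teichmüller pair on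
the rational line, restricted to `K`; any ramified `Cbar`), with the hypotheses of 3a-A (`Good`, `Red`, `Anom`, (hlat), the DATUM,
`K` data) and nothing else: Kriz (1) at `ℓ = p` is `GoodLatticeKrizTraceConditionAtP.kriz_one_at_p_of_anom` (`θquot(Frob_p) = 1` at an
anomalous prime, `a_p ≡ 1 + p`). So 3a-A at this call shape is a consequence of {a PUBLISHED proof step of CGLS 2022 (Invent. Math.
227), Hida 2010 Thm. I (Ann. of Math. 172)} BY NAME and the kernel — the composed / preprint label of 3a-A is no longer load-bearing
for these consumers.

* `anacongQ_of_proofThm221_of_thmI_of_datum` — the displayed statement (all of Kriz's (1)–(5) and the type discharged in the kernel: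
  `GoodLatticeKrizTraceCondition`, `GoodLatticeKrizTraceConditionAtP`, `GoodLatticeKrizDescentTypeOfDatum`).
* **`thm222_anacong_goodLattice_of_fullDescentDatum_of_proofThm221_of_thmI`** — the REGISTERED statement of content stub 3a-A,
  `KellerYin2024.thm222_anacong_goodLattice_of_fullDescentDatum`, BY NAME, from the two named facts: every `K`-residual pair is the
  restriction of the ℚ-Teichmüller pair (tree: `ResidualLineRigidity.residualPair_eq_restrictField`; the pair exists, `exists_teichmullerPair_of_line`).

HONEST FRAMING: theorems only (0 definitions, 0 named facts, 0 sorry); CONDITIONAL on the two named facts by name — so 3a-A becomes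
«{CGLS 2022 proof of Thm. 2.2.1 from (eq:cong-mf) [research-PUB, Invent. Math. 227], Hida 2010 Thm. I [research-PUB, Ann. of Math. 172]}
⟹ 3a-A» in the kernel; it does NOT close the stub unconditionally and the LEAD decides the restub (e.g. citing the two facts in
`stub_printInputs`); 0 cells / labels / tiers move; no summit statement, no case of BSD, no theorem of CGLS /
Kriz / Hida / Keller–Yin is proved here. References: [CastellaGrossiLeeSkinner2022] Thm. 2.2.1 and proof of Thm. 2.2.2;
[Kriz2016] Def. 31, Rem. 32–33, Thm. 34, Thm. 35; [Hida2010MuInvariant] Thm. I; [KellerYin2024] Thm. 2.2.2 (statement shape).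
-/

set_option autoImplicit false
set_option linter.dupNamespace false

noncomputable section

open scoped Classical

open WeierstrassCurve NumberField IsDedekindDomain Field PowerSeries
  Literature.NumberTheory.EllipticCurves Literature.NumberTheory.EllipticCurves.Rank1Residual
  Literature.NumberTheory.EllipticCurves.ModularForms
  Literature.NumberTheory.GaloisRepresentations Literature.NumberTheory.QuadraticFields
  Literature.NumberTheory.EllipticCurves.GreenbergSelmer
  Literature.NumberTheory.EllipticCurves.CastellaGrossiLeeSkinner2022
  Literature.NumberTheory.EllipticCurves.KellerYin2024
  Literature.NumberTheory.EllipticCurves.Hida2010MuInvariant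
  Summit.BirchSwinnertonDyer.Rank1Residual.X11b.Halves

namespace Summit.BirchSwinnertonDyer.BirchSwinnertonDyer.Theorems.GoodLatticeAnacongOfCGLSProofOfDatum

/-- **[AN] at the ℚ-Teichmüller call shape from {CGLS's proof of Thm. 2.2.1, Hida's Thm. I} BY NAME, under the hypotheses of 3a-A.**
See the module docstring. [cite: CastellaGrossiLeeSkinner2022, Thm. 2.2.1 and proof of Thm. 2.2.2 (arXiv:2008.02571v2 TeX L1051–1153)]
[cite: Kriz2016, Def. 31, Rem. 32, Rem. 33, Thm. 34 (2)(3), Thm. 35] [cite: Hida2010MuInvariant, Thm. I (p. 45)]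
[cite: KellerYin2024, Thm. 2.2.2 (statement shape; arXiv:2402.12781v2 TeX L1445–1448)] -/
theorem anacongQ_of_proofThm221_of_thmI_of_datum (h221 : proofThm221_congruence_of_fullEisensteinDescent)
    (hI : thmI_mu_katzLFunction_eq_zero) :
    ∀ (W : WeierstrassCurve ℚ) [W.IsElliptic] [W.IsGloballyMinimal] (p : ℕ) [Fact p.Prime],
      2 < p → Good W p → Red W p → Anom W p →
      ((∃ (ℓ : ℕ) (hℓ : ℓ.Prime), haveI : Fact ℓ.Prime := ⟨hℓ⟩; Addv W ℓ) ∨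
        (∃ (ℓ : ℕ) (hℓ : ℓ.Prime), haveI : Fact ℓ.Prime := ⟨hℓ⟩;
          W.HasMultiplicativeReductionAtPrime ℓ ∧
            ((W.HasSplitMultiplicativeReductionAtPrime ℓ ∧ ℓ ≡ 1 [MOD p]) ∨
              (¬ W.HasSplitMultiplicativeReductionAtPrime ℓ ∧ ℓ + 1 ≡ 0 [MOD p])))) →
      (∀ Φ : AddSubgroup (geomTorsion W (p : ℤ)), IsRationalLine W p Φ → ¬ LineUnramifiedAt W p Φ) →
      ∀ (K : Type) [Field K] [NumberField K], IsImaginaryQuadratic K →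
        SatisfiesHeegnerHypothesis (W.conductorNorm ℤ) K → SatisfiesHeegnerHypothesis p K →
        Odd (NumberField.discr K) → NumberField.discr K ≠ -3 →
      ∀ (ι : K →+* ℚ_[p]) (v vbar : HeightOneSpectrum (𝓞 K)),
        (∀ x : 𝓞 K, x ∈ v.asIdeal ↔ ‖ι (x : K)‖ < 1) →
        ((p : ℕ) : 𝓞 K) ∈ vbar.asIdeal → vbar ≠ v →
      ∀ (κ : ZpExtension K p), κ.IsAnticyclotomic →
      ∀ (γ : absoluteGaloisGroup K) [Fact (κ.IsTopGenerator γ)],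
      ∀ (N : ℕ) [NeZero N] (Dt : ModularParametrizationData W N),
      ∀ (ι' : PadicAlgCl p ≃+* ℂ),
        (∀ (w : InfinitePlace K) (k : 𝓞 K), k ∈ v.asIdeal ↔ ‖ι'.symm (w.embedding (k : K))‖ < 1) →
      ∀ (ΩK : ℂ) (Ωp : (unrIntegers p)ˣ) (L : UnrSeries p), ΩK ≠ 0 →
        IsBDPLFunction ι' v κ γ Dt.f ΩK ((Ωp : unrIntegers p) : ℂ_[p]) L →
      ∀ (Φ : AddSubgroup (geomTorsion W (p : ℤ))), IsRationalLine W p Φ →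
      ∀ (θsub θquot : FramedGaloisRep ℚ (padicCoeffIntegers (∅ : Set (PadicAlgCl p))) 1),
        IsTeichmullerLiftOn (∅ : Set (PadicAlgCl p)) (Φ.map (geomTorsion W (p : ℤ)).subtype) θsub →
        IsTeichmullerLiftOnQuot (∅ : Set (PadicAlgCl p)) (Φ.map (geomTorsion W (p : ℤ)).subtype)
          (geomTorsion W (p : ℤ)) θquot →
      ∀ (Sf : Finset (HeightOneSpectrum (𝓞 K))),
        (∀ w : HeightOneSpectrum (𝓞 K), w ∈ Sf ↔ ((W.conductorNorm ℤ : ℤ) : 𝓞 K) ∈ w.asIdeal) →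
      ∀ (θK : HeckeCharacter K), IsHeckeCharOf ι' (θquot.restrictField K) θK →
      ∀ (Cbar : Finset (HeightOneSpectrum (𝓞 K))), (∀ u ∈ Cbar, ¬ θK.IsUnramifiedAt u) →
      ∀ (ΩK' : ℂ) (Ωp' : (unrIntegers p)ˣ) (Lφ : UnrSeries p), ΩK' ≠ 0 →
        IsKatzLFunction ι' v vbar Cbar κ γ θK ΩK' ((Ωp' : unrIntegers p) : ℂ_[p]) Lφ →
      ∃ n nφ : ℕ, FirstUnitCoeffAt L n ∧ FirstUnitCoeffAt Lφ nφ ∧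
        n + ∑ w ∈ Sf, curveLocalLambda κ (W.baseChange K) w =
          2 * nφ + ∑ w ∈ Sf, (charLocalLambda ∅ κ (θsub.restrictField K) w + charLocalLambda ∅ κ (θquot.restrictField K) w) := by
  intro W _ _ p _ hp hgood hred hanom hdatum hGL K _ _ hK hHN hHp hodd h3 ι v vbar hv hvbar hne κ hκ γ _ N _ Dt ι' hι'
    ΩK Ωp L hΩK hL Φ hΦ θsub θquot hsub hquot Sf hSf θK hθK Cbar hC ΩK' Ωp' Lφ hΩK' hLφ
  have hpp : p.Prime := Fact.out
  -- the type with (2)–(5) from the datum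
  obtain ⟨Nplus, Nminus, Nzero, hNp, hNm, hNz, htype, h2, h3', h4, h5⟩ :=
    GoodLatticeKrizDescentTypeOfDatum.exists_fullDescentType_of_datum W hgood hΦ hsub hquot hdatum
  -- (1): at `ℓ = p` by `Ẽ[p] ⊆ Ẽ(𝔽_p)` (anomalous), at the good `ℓ ≠ p` by Mazur's Prop. 6.3 (1)
  have h1 : ∀ (ℓ : ℕ) (u : HeightOneSpectrum (𝓞 ℚ)), ℓ.Prime → ((ℓ : ℕ) : 𝓞 ℚ) ∈ u.asIdeal →
      ¬ ℓ ∣ W.conductorNorm ℤ → ∀ a : padicCoeffIntegers (∅ : Set (PadicAlgCl p)),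
      θquot.HasFrobCharpolyAt u (Polynomial.X - Polynomial.C a) →
      ‖((W.LFunction ℓ : ℤ) : PadicAlgCl p) - ((a : PadicAlgCl p) + (a : PadicAlgCl p)⁻¹ * (ℓ : PadicAlgCl p))‖ < 1 := by
    intro ℓ u hℓ hu hℓN a ha
    by_cases hℓp : ℓ = p
    · subst hℓp
      exact GoodLatticeKrizTraceConditionAtP.kriz_one_at_p_of_anom W hanom hGL hΦ hquot hu ha
    · haveI : Fact ℓ.Prime := ⟨hℓ⟩
      exact GoodLatticeKrizTraceCondition.kriz_one_of_hasGoodReductionAtPrime W hΦ hquot hℓp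
        (W.hasGoodReductionAtPrime_of_not_dvd_conductorNorm' hℓN) hu ha
  exact GoodLatticeAnacongOfCGLSProofThm221.anacong_of_proofThm221_of_thmI h221 hI W p hp hgood hred hanom hGL K hK hHN hHp
    hodd h3 ι v vbar hv hvbar hne κ hκ γ N Dt ι' hι' ΩK Ωp L hΩK hL Φ hΦ θsub θquot hsub hquot Nplus Nminus Nzero hNp hNm hNz
    htype h1 h2 h3' h4 h5 Sf hSf θK hθK Cbar hC ΩK' Ωp' Lφ hΩK' hLφ

/-- **The Teichmüller pair `(ω̃, 𝟙̃)` of `G_ℚ` on a given rational `p`-line exists** (`KellerYin2024.teichmullerLiftOnQuot`; `E[p](ℚ̄)` has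
order `p²` and open point stabilisers). [cite: KellerYin2024, §1.4 (arXiv:2402.12781v2 TeX L1063–1086)] -/
theorem exists_teichmullerPair_of_line (W : WeierstrassCurve ℚ) [W.IsElliptic] (p : ℕ) [hp : Fact p.Prime]
    {Φ : AddSubgroup (geomTorsion W (p : ℤ))} (hΦ : IsRationalLine W p Φ) :
    ∃ (θsub θquot : FramedGaloisRep ℚ (padicCoeffIntegers (∅ : Set (PadicAlgCl p))) 1),
      IsTeichmullerLiftOn (∅ : Set (PadicAlgCl p)) (Φ.map (geomTorsion W (p : ℤ)).subtype) θsub ∧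
      IsTeichmullerLiftOnQuot (∅ : Set (PadicAlgCl p)) (Φ.map (geomTorsion W (p : ℤ)).subtype)
        (geomTorsion W (p : ℤ)) θquot := by
  -- adapted verbatim from `CumulativeHeegnerLeopoldtEisensteinCharacterInvariantsAtThree.CharacterCutEq.exists_teichmullerPair_of_line`
  -- (same statement; re-proved here to keep this file's import cone free of other routes' files)
  obtain ⟨hcard, hstab⟩ := hΦ
  have hp0 : p ≠ 0 := hp.out.ne_zero
  have hTstab : ∀ σ : absoluteGaloisGroup ℚ, ∀ P ∈ geomTorsion W (p : ℤ), σ • P ∈ geomTorsion W (p : ℤ) :=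
    fun σ P hP ↦ by
    rw [mem_geomTorsion_iff] at hP ⊢
    rw [smul_comm, hP, smul_zero]
  have hNstab : ∀ σ : absoluteGaloisGroup ℚ, ∀ P ∈ Φ.map (geomTorsion W (p : ℤ)).subtype,
      σ • P ∈ Φ.map (geomTorsion W (p : ℤ)).subtype := by
    rintro σ _ ⟨P, hPmem, rfl⟩
    exact ⟨σ • P, hstab σ P hPmem, rfl⟩
  have hbot : ∀ σ : absoluteGaloisGroup ℚ, ∀ P ∈ (⊥ : AddSubgroup (geomPoints W)),
      σ • P ∈ (⊥ : AddSubgroup (geomPoints W)) := fun σ P hP ↦ by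
    rw [AddSubgroup.mem_bot] at hP ⊢; rw [hP, smul_zero]
  have hTcard : Nat.card (geomTorsion W (p : ℤ)) = p ^ 2 :=
    card_torsionPoints_eq_sq_holds W (AlgebraicClosure ℚ) (n := p) (by exact_mod_cast hp0)
  have hTfin : (geomTorsion W (p : ℤ) : Set (geomPoints W)).Finite := by
    have : Finite (geomTorsion W (p : ℤ)) := Nat.finite_of_card_ne_zero (by rw [hTcard]; positivity)
    exact Set.toFinite _
  have hle : Φ.map (geomTorsion W (p : ℤ)).subtype ≤ geomTorsion W (p : ℤ) := by
    rintro _ ⟨P, _, rfl⟩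
    exact P.2
  have hNfin : (Φ.map (geomTorsion W (p : ℤ)).subtype : Set (geomPoints W)).Finite := hTfin.subset hle
  have hstabT : ∀ P ∈ geomTorsion W (p : ℤ),
      IsOpen ((MulAction.stabilizer (absoluteGaloisGroup ℚ) P : Subgroup _) : Set (absoluteGaloisGroup ℚ)) :=
    fun P _ ↦ isOpen_stabilizer_point_holds W P
  have hstabN : ∀ P ∈ Φ.map (geomTorsion W (p : ℤ)).subtype,
      IsOpen ((MulAction.stabilizer (absoluteGaloisGroup ℚ) P : Subgroup _) : Set (absoluteGaloisGroup ℚ)) :=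
    fun P hP ↦ hstabT P (hle hP)
  have hNcard : Nat.card (Φ.map (geomTorsion W (p : ℤ)).subtype) = p := by
    rw [Nat.card_congr (Φ.equivMapOfInjective (geomTorsion W (p : ℤ)).subtype
      (geomTorsion W (p : ℤ)).subtype_injective).toEquiv.symm, hcard]
  have hidx1 : (⊥ : AddSubgroup (geomPoints W)).relIndex (Φ.map (geomTorsion W (p : ℤ)).subtype) = p := by
    rw [AddSubgroup.relIndex_bot_left, hNcard]
  have hidx2 : (Φ.map (geomTorsion W (p : ℤ)).subtype).relIndex (geomTorsion W (p : ℤ)) = p := by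
    have h := AddSubgroup.relIndex_mul_relIndex (⊥ : AddSubgroup (geomPoints W))
      (Φ.map (geomTorsion W (p : ℤ)).subtype) (geomTorsion W (p : ℤ)) bot_le hle
    rw [hidx1, AddSubgroup.relIndex_bot_left, hTcard, sq] at h
    exact Nat.eq_of_mul_eq_mul_left hp.out.pos h
  exact ⟨teichmullerLiftOnQuot ∅ hbot hNstab hidx1 hNfin hstabN,
    teichmullerLiftOnQuot ∅ hNstab hTstab hidx2 hTfin hstabT,
    isTeichmullerLiftOnQuot_teichmullerLiftOnQuot ∅ hbot hNstab hidx1 hNfin hstabN,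
    isTeichmullerLiftOnQuot_teichmullerLiftOnQuot ∅ hNstab hTstab hidx2 hTfin hstabT⟩

/-- **Content stub 3a-A BY NAME from the two named facts.** `KellerYin2024.thm222_anacong_goodLattice_of_fullDescentDatum` (the registered
signature of the content stub of crux 2, line `halves`: arbitrary `K`-residual pairs `IsResidualPairOver (W/K) p θsub θquot`) follows from
`CastellaGrossiLeeSkinner2022.proofThm221_congruence_of_fullEisensteinDescent` and `Hida2010MuInvariant.thmI_mu_katzLFunction_eq_zero`:
every `K`-residual pair is the restriction of the ℚ-Teichmüller pair of the (unique) rational `p`-line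
(`ResidualLineRigidity.residualPair_eq_restrictField`), to which `anacongQ_of_proofThm221_of_thmI_of_datum` applies.
[cite: CastellaGrossiLeeSkinner2022, Thm. 2.2.1 and proof of Thm. 2.2.2] [cite: Hida2010MuInvariant, Thm. I (p. 45)]
[cite: Kriz2016, Def. 31, Thm. 34, Thm. 35] [cite: KellerYin2024, Thm. 2.2.2 and §1.4 (arXiv:2402.12781v2)] -/
theorem thm222_anacong_goodLattice_of_fullDescentDatum_of_proofThm221_of_thmI
    (h221 : proofThm221_congruence_of_fullEisensteinDescent) (hI : thmI_mu_katzLFunction_eq_zero) :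
    KellerYin2024.thm222_anacong_goodLattice_of_fullDescentDatum := by
  intro W _ _ p _ hp hgood hred hanom hdatum hGL K _ _ hK hHN hHp hodd h3 _hEK ι v vbar hv hvbar hne κ hκ γ _ N _ Dt ι' hι'
    ΩK Ωp L hΩK hL θsub θquot hpair Sf hSf θK hθK Cbar hC ΩK' Ωp' Lφ hΩK' hLφ
  obtain ⟨Φ₀, hΦ₀⟩ := exists_isRationalLine_of_not_irr (W := W) (p := p) hred
  obtain ⟨θsub₀, θquot₀, hsub₀, hquot₀⟩ := exists_teichmullerPair_of_line W p hΦ₀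
  obtain ⟨rfl, rfl⟩ :=
    ResidualLineRigidity.residualPair_eq_restrictField W p K (by omega) hanom hGL hK hΦ₀ hsub₀ hquot₀ hpair
  exact anacongQ_of_proofThm221_of_thmI_of_datum h221 hI W p hp hgood hred hanom hdatum hGL K hK hHN hHp hodd h3 ι v vbar hv
    hvbar hne κ hκ γ N Dt ι' hι' ΩK Ωp L hΩK hL Φ₀ hΦ₀ θsub₀ θquot₀ hsub₀ hquot₀ Sf hSf θK hθK Cbar hC ΩK' Ωp' Lφ hΩK' hLφ

end Summit.BirchSwinnertonDyer.BirchSwinnertonDyer.Theorems.GoodLatticeAnacongOfCGLSProofOfDatum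

end
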